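import Mathlib
import Summits.Ventures.PercRepro2.Defs
import Summits.Ventures.PercRepro2.Independence
import Summits.Ventures.PercRepro2.Harris
import Summits.Ventures.PercRepro2.Graph
import Summits.Ventures.PercRepro2.OneEdge
import Summits.Ventures.PercRepro2.XWForm
import Summits.Ventures.PercRepro2.XWMore
import Summits.Ventures.PercRepro2.XWEdgeSY

/-!
# The (XW) form across the `y–u` edge (and, by symmetry, the `s–o` edge): the exact concavity
defect (PercRepro2, p2 g26)

`XW(p) = xwBil p p = P(aλ) + P(Sa)P(Sλ) − P(a)P(λ) − P(S)P(Saλ)` with `a = {s ↔ u}`,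
`λ = {y ↔ o}`, `S = {s ↔ y}`, `Q = Sᶜ` (XWForm.lean).  Let `e` be an edge with ends `{y, u}` and
`t = p e`.  Forcing `e` open identifies `S` and `a` with `S' = S ∪ a` and turns `λ` into
`L = λ ∪ {u ↔ o}` (`OneEdge.conn_update_true_iff`), so `XW(p[e↦1]) = Cov(S', L) ≥ 0` by Harris
(`xwBil_update_one_eq_cov`, `cov_SL_nonneg`) — the `u = y` coincidence — and the one-edge
Bernstein expansion `xxwBil_bernstein` collapses to the **exact identity**

  `XW(p) = (1 − t)·XW(p[e↦0]) + t·Cov_{p[e↦0]}(S', L) + t(1 − t)·D_yu(p[e↦0])`   (`xwBil_eq_yu_edge`),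

with the concavity defect

  `D_yu = P(S ∩ aᶜ)·P(Q ∩ aᶜ ∩ λᶜ ∩ {u ↔ o}) + P(Q ∩ a)·P(S ∩ aᶜ ∩ λ) − P(S ∩ aᶜ)·P(Q ∩ a ∩ λ)`

(`dYU`; the cells: `s ↔ y ↮ u`, `u ↔ o` away from both `s` and `y`, `s ↔ u ↮ y`, `s ↔ y ↔ o ↮ u`,
`s ↔ u, y ↔ o, s ↮ y`).  Consequences: `xwBil_nonneg_of_dYU_nonneg` — if `0 ≤ D_yu` (the
conjecture (C-yu) of record P2-G25-XWSTRUCT.md §9, «XW is concave in `p_yu`») and (XW) holds with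
`e` closed, then (XW) holds at `p`; and by the `(s, u) ↔ (y, o)` symmetry `xwBil_swap` the same for
an edge `{s, o}` (`xwBil_eq_so_edge`, `xwBil_nonneg_of_dSO_nonneg`), so that, together with
XWEdgeSY.lean, every «non-realising» mark-pair edge `s–y`, `y–u`, `s–o` is exactly accounted for.
Own work; standard axioms.
-/

namespace Summit.Ventures.PercRepro2

namespace XWEdgeYU

variable {V : Type*} {E : Type*} [Fintype E] [DecidableEq E] {R : Type*} [CommRing R]

variable (ends : E → Sym2 V) (s y o u : V)

/-- `S' = {s ↔ y} ∪ {s ↔ u}`: `s` is connected to the pair `{y, u}`. -/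
def Sp : Set (Config E) := connEvent ends s y ∪ connEvent ends s u

/-- `L = {y ↔ o} ∪ {u ↔ o}`: `o` is connected to the pair `{y, u}`. -/
def L : Set (Config E) := connEvent ends y o ∪ connEvent ends u o

variable {ends s y}

omit [Fintype E] in
/-- With `e = {y, u}` forced open, `{s ↔ y}` is `S'`. -/
lemma preimage_S {e : E} (he : ends e = s(y, u)) :
    {ω : Config E | Function.update ω e true ∈ connEvent ends s y} = Sp ends s y u := by
  ext ω
  simp only [Set.mem_setOf_eq, mem_connEvent, Sp, Set.mem_union]
  rw [OneEdge.conn_update_true_iff he]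
  constructor
  · rintro (h | ⟨h, _⟩ | ⟨h, _⟩)
    · exact Or.inl h
    · exact Or.inl h
    · exact Or.inr h
  · rintro (h | h)
    · exact Or.inl h
    · exact Or.inr (Or.inr ⟨h, conn_refl ends ω y⟩)

omit [Fintype E] in
/-- With `e = {y, u}` forced open, `{s ↔ u}` is `S'`. -/
lemma preimage_a {e : E} (he : ends e = s(y, u)) :
    {ω : Config E | Function.update ω e true ∈ connEvent ends s u} = Sp ends s y u := by
  ext ω
  simp only [Set.mem_setOf_eq, mem_connEvent, Sp, Set.mem_union]
  rw [OneEdge.conn_update_true_iff he]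
  constructor
  · rintro (h | ⟨h, _⟩ | ⟨h, _⟩)
    · exact Or.inr h
    · exact Or.inl h
    · exact Or.inr h
  · rintro (h | h)
    · exact Or.inr (Or.inl ⟨h, conn_refl ends ω u⟩)
    · exact Or.inl h

omit [Fintype E] in
/-- With `e = {y, u}` forced open, `{y ↔ o}` is `L`. -/
lemma preimage_l {e : E} (he : ends e = s(y, u)) :
    {ω : Config E | Function.update ω e true ∈ connEvent ends y o} = L ends y o u := by
  ext ω
  simp only [Set.mem_setOf_eq, mem_connEvent, L, Set.mem_union]
  rw [OneEdge.conn_update_true_iff he]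
  constructor
  · rintro (h | ⟨_, h⟩ | ⟨_, h⟩)
    · exact Or.inl h
    · exact Or.inr h
    · exact Or.inl h
  · rintro (h | h)
    · exact Or.inl h
    · exact Or.inr (Or.inl ⟨conn_refl ends ω y, h⟩)

omit [Fintype E] [DecidableEq E] in
/-- `S'` is increasing. -/
lemma isUpperSet_Sp : IsUpperSet (Sp ends s y u) :=
  (isUpperSet_connEvent ends s y).union (isUpperSet_connEvent ends s u)

omit [Fintype E] [DecidableEq E] in
/-- `L` is increasing. -/
lemma isUpperSet_L : IsUpperSet (L ends y o u) :=
  (isUpperSet_connEvent ends y o).union (isUpperSet_connEvent ends u o)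

/-! ## The pinned-open form is a Harris covariance -/

variable (ends s y) in
/-- `B(p₁, p₁) = P(S' ∩ L) − P(S')P(L)` (all under `p[e↦0]`): the `u = y` coincidence. -/
theorem xwBil_update_one_eq_cov (p : E → R) {e : E} (he : ends e = s(y, u)) :
    xwBil ends s y o u (Function.update p e 1) (Function.update p e 1) =
      prob (Function.update p e 0) (Sp ends s y u ∩ L ends y o u) -
        prob (Function.update p e 0) (Sp ends s y u) * prob (Function.update p e 0) (L ends y o u) := by
  unfold xwBil
  simp only [XWEdgeSY.prob_update_one_eq_update_zero_preimage p e, XWEdgeSY.preimage_inter,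
    preimage_S u he, preimage_a u he, preimage_l o u he, Set.inter_self]
  ring

variable (ends s y) in
/-- `0 ≤ P(S' ∩ L) − P(S')P(L)` by Harris. -/
theorem cov_SL_nonneg [LinearOrder R] [IsStrictOrderedRing R] {p : E → R} (hp : IsProbVec p) :
    0 ≤ prob p (Sp ends s y u ∩ L ends y o u) - prob p (Sp ends s y u) * prob p (L ends y o u) :=
  sub_nonneg.mpr (prob_mul_prob_le_prob_inter hp (isUpperSet_Sp u) (isUpperSet_L o u))

/-! ## The defect and the identity -/

variable (ends s y) in
/-- **The `y–u` concavity defect**: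
`D_yu = P(S ∩ aᶜ)·P(Q ∩ aᶜ ∩ λᶜ ∩ {u ↔ o}) + P(Q ∩ a)·P(S ∩ aᶜ ∩ λ) − P(S ∩ aᶜ)·P(Q ∩ a ∩ λ)`. -/
noncomputable def dYU (p : E → R) : R :=
  prob p (connEvent ends s y ∩ (connEvent ends s u)ᶜ) *
      prob p ((connEvent ends s y)ᶜ ∩ (connEvent ends s u)ᶜ ∩ (connEvent ends y o)ᶜ ∩
        connEvent ends u o) +
    prob p ((connEvent ends s y)ᶜ ∩ connEvent ends s u) *
      prob p (connEvent ends s y ∩ (connEvent ends s u)ᶜ ∩ connEvent ends y o) -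
    prob p (connEvent ends s y ∩ (connEvent ends s u)ᶜ) *
      prob p ((connEvent ends s y)ᶜ ∩ connEvent ends s u ∩ connEvent ends y o)

omit [Fintype E] [DecidableEq E] in
/-- `S' = S ⊔ (Q ∩ a)`. -/
lemma Sp_eq : Sp ends s y u = connEvent ends s y ∪ (connEvent ends s y)ᶜ ∩ connEvent ends s u := by
  ext ω
  simp only [Sp, Set.mem_union, Set.mem_inter_iff, Set.mem_compl_iff]
  tauto

omit [Fintype E] [DecidableEq E] in
/-- `L = λ ⊔ (λᶜ ∩ {u ↔ o})`. -/
lemma L_eq : L ends y o u = connEvent ends y o ∪ (connEvent ends y o)ᶜ ∩ connEvent ends u o := by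
  ext ω
  simp only [L, Set.mem_union, Set.mem_inter_iff, Set.mem_compl_iff]
  tauto

omit [Fintype E] [DecidableEq E] in
/-- `S` and `Q ∩ a` are disjoint. -/
lemma disjoint_S_Qa :
    Disjoint (connEvent ends s y) ((connEvent ends s y)ᶜ ∩ connEvent ends s u) := by
  rw [Set.disjoint_left]
  rintro ω h ⟨h', _⟩
  exact h' h

omit [Fintype E] [DecidableEq E] in
/-- `λ` and `λᶜ ∩ {u ↔ o}` are disjoint. -/
lemma disjoint_l_rho :
    Disjoint (connEvent ends y o) ((connEvent ends y o)ᶜ ∩ connEvent ends u o) := by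
  rw [Set.disjoint_left]
  rintro ω h ⟨h', _⟩
  exact h' h

variable (ends s y) in
/-- **The mixed coefficients**: `B(p₀, p₁) + B(p₁, p₀) = XW(p₀) + Cov(S', L) + D_yu(p₀)` for
`e = {y, u}`. -/
theorem xwBil_mixed_eq (p : E → R) {e : E} (he : ends e = s(y, u)) :
    xwBil ends s y o u (Function.update p e 0) (Function.update p e 1) +
        xwBil ends s y o u (Function.update p e 1) (Function.update p e 0) =
      xwBil ends s y o u (Function.update p e 0) (Function.update p e 0) +
        (prob (Function.update p e 0) (Sp ends s y u ∩ L ends y o u) -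
          prob (Function.update p e 0) (Sp ends s y u) *
            prob (Function.update p e 0) (L ends y o u)) +
        dYU ends s y o u (Function.update p e 0) := by
  unfold xwBil dYU
  simp only [XWEdgeSY.prob_update_one_eq_update_zero_preimage p e, XWEdgeSY.preimage_inter,
    preimage_S u he, preimage_a u he, preimage_l o u he, Set.inter_self]
  set q := Function.update p e 0 with hq
  set S := connEvent ends s y with hS
  set a := connEvent ends s u with ha
  set l := connEvent ends y o with hl
  set r := connEvent ends u o with hr
  -- the atoms
  set x1 := prob q (S ∩ a ∩ l) with hx1
  set x2 := prob q (S ∩ a) with hx2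
  set x3 := prob q (S ∩ aᶜ ∩ l) with hx3
  set x4 := prob q (S ∩ aᶜ) with hx4
  set x5 := prob q (Sᶜ ∩ a ∩ l) with hx5
  set x6 := prob q (Sᶜ ∩ a) with hx6
  set y1 := prob q l with hy1
  set r1 := prob q (S ∩ (lᶜ ∩ r)) with hr1
  set r2 := prob q (Sᶜ ∩ a ∩ (lᶜ ∩ r)) with hr2
  set r3 := prob q (Sᶜ ∩ aᶜ ∩ lᶜ ∩ r) with hr3
  -- the splits
  have eSp : prob q (Sp ends s y u) = (x2 + x4) + x6 := by
    rw [Sp_eq, prob_union_of_disjoint q (disjoint_S_Qa u),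
      ← prob_inter_add_prob_inter_compl q S a]
  have eS : prob q S = x2 + x4 := by rw [← prob_inter_add_prob_inter_compl q S a]
  have eL : prob q (L ends y o u) = y1 + (r1 + r2 + r3) := by
    rw [L_eq, prob_union_of_disjoint q (disjoint_l_rho o u)]
    congr 1
    -- `lᶜ ∩ r` split along `S`, then along `a`
    rw [← prob_inter_add_prob_inter_compl q (lᶜ ∩ r) S, Set.inter_comm (lᶜ ∩ r) S,
      Set.inter_comm (lᶜ ∩ r) Sᶜ, ← prob_inter_add_prob_inter_compl q (Sᶜ ∩ (lᶜ ∩ r)) a]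
    have e1 : Sᶜ ∩ (lᶜ ∩ r) ∩ a = Sᶜ ∩ a ∩ (lᶜ ∩ r) := by
      ext ω; simp only [Set.mem_inter_iff]; tauto
    have e2 : Sᶜ ∩ (lᶜ ∩ r) ∩ aᶜ = Sᶜ ∩ aᶜ ∩ lᶜ ∩ r := by
      ext ω; simp only [Set.mem_inter_iff]; tauto
    rw [e1, e2, ← hr1, ← hr2, ← hr3]
    ring
  have eSpL : prob q (Sp ends s y u ∩ L ends y o u) = (x1 + x3) + r1 + x5 + r2 := by
    rw [Sp_eq, L_eq, Set.union_inter_distrib_right, Set.inter_union_distrib_left,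
      Set.inter_union_distrib_left]
    have d1 : Disjoint (S ∩ l ∪ S ∩ (lᶜ ∩ r))
        (Sᶜ ∩ a ∩ l ∪ Sᶜ ∩ a ∩ (lᶜ ∩ r)) := by
      rw [Set.disjoint_left]
      rintro ω (⟨hS', _⟩ | ⟨hS', _⟩) (⟨⟨hQ, _⟩, _⟩ | ⟨⟨hQ, _⟩, _⟩) <;> exact hQ hS'
    have d2 : Disjoint (S ∩ l) (S ∩ (lᶜ ∩ r)) := by
      rw [Set.disjoint_left]
      rintro ω ⟨_, hl'⟩ ⟨_, hl'', _⟩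
      exact hl'' hl'
    have d3 : Disjoint (Sᶜ ∩ a ∩ l) (Sᶜ ∩ a ∩ (lᶜ ∩ r)) := by
      rw [Set.disjoint_left]
      rintro ω ⟨_, hl'⟩ ⟨_, hl'', _⟩
      exact hl'' hl'
    rw [prob_union_of_disjoint q d1, prob_union_of_disjoint q d2, prob_union_of_disjoint q d3]
    have eSl : prob q (S ∩ l) = x1 + x3 := by
      rw [← prob_inter_add_prob_inter_compl q (S ∩ l) a, Set.inter_right_comm S l a,
        Set.inter_right_comm S l aᶜ]
    rw [eSl]
    ring
  have ea : prob q a = x2 + x6 := by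
    rw [← prob_inter_add_prob_inter_compl q a S, Set.inter_comm a S, Set.inter_comm a Sᶜ]
  have eSl : prob q (S ∩ l) = x1 + x3 := by
    rw [← prob_inter_add_prob_inter_compl q (S ∩ l) a, Set.inter_right_comm S l a,
      Set.inter_right_comm S l aᶜ]
  have eal : prob q (a ∩ l) = x1 + x5 := by
    rw [← prob_inter_add_prob_inter_compl q (a ∩ l) S, Set.inter_comm (a ∩ l) S,
      Set.inter_comm (a ∩ l) Sᶜ, ← Set.inter_assoc, ← Set.inter_assoc]
  rw [eSp, eS, eL, eSpL, ea, eSl, eal]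
  ring

variable (ends s y) in
/-- **The exact `y–u` edge identity**:
`XW(p) = (1 − t)·XW(p[e↦0]) + t·Cov_{p[e↦0]}(S', L) + t(1 − t)·D_yu(p[e↦0])`, `t = p e`,
for an edge `e = {y, u}`. -/
theorem xwBil_eq_yu_edge (p : E → R) {e : E} (he : ends e = s(y, u)) :
    xwBil ends s y o u p p =
      (1 - p e) * xwBil ends s y o u (Function.update p e 0) (Function.update p e 0) +
        p e * (prob (Function.update p e 0) (Sp ends s y u ∩ L ends y o u) -
          prob (Function.update p e 0) (Sp ends s y u) *
            prob (Function.update p e 0) (L ends y o u)) +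
        p e * (1 - p e) * dYU ends s y o u (Function.update p e 0) := by
  have hB := xxwBil_bernstein ends s y o u p p e
  have h11 := xwBil_update_one_eq_cov ends s y o u p he
  have hmix := xwBil_mixed_eq ends s y o u p he
  rw [hB, h11]
  linear_combination (p e * (1 - p e)) * hmix

variable (ends s y) in
/-- **The `y–u` edge-removal reduction**: if `0 ≤ D_yu` ((C-yu) at `p[e↦0]`) and (XW) holds with
`e` closed, then (XW) holds at `p`. -/
theorem xwBil_nonneg_of_dYU_nonneg [LinearOrder R] [IsStrictOrderedRing R] {p : E → R}
    (hp : IsProbVec p) {e : E} (he : ends e = s(y, u))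
    (hD : 0 ≤ dYU ends s y o u (Function.update p e 0))
    (h0 : 0 ≤ xwBil ends s y o u (Function.update p e 0) (Function.update p e 0)) :
    0 ≤ xwBil ends s y o u p p := by
  rw [xwBil_eq_yu_edge ends s y o u p he]
  have h1 : 0 ≤ 1 - p e := by linarith [hp.le_one e]
  have h2 : 0 ≤ p e := hp.nonneg e
  have h3 := cov_SL_nonneg ends s y o u (hp.update e (le_refl 0) zero_le_one)
  positivity

/-! ## The `s–o` edge by the `(s, u) ↔ (y, o)` symmetry -/

variable (ends s y) in
/-- **The exact `s–o` edge identity** (the `(s, u) ↔ (y, o)` image of `xwBil_eq_yu_edge`): for an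
edge `e = {s, o}`, `XW(s, y, o, u)` is `(1 − t)·XW(p[e↦0]) + t·Cov(S'', L'') + t(1 − t)·D_so` with
`S'' = {y ↔ s} ∪ {y ↔ o}`, `L'' = {s ↔ u} ∪ {o ↔ u}`, `D_so = D_yu` at the swapped marks. -/
theorem xwBil_eq_so_edge (p : E → R) {e : E} (he : ends e = s(s, o)) :
    xwBil ends s y o u p p =
      (1 - p e) * xwBil ends s y o u (Function.update p e 0) (Function.update p e 0) +
        p e * (prob (Function.update p e 0) (Sp ends y s o ∩ L ends s u o) -
          prob (Function.update p e 0) (Sp ends y s o) *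
            prob (Function.update p e 0) (L ends s u o)) +
        p e * (1 - p e) * dYU ends y s u o (Function.update p e 0) := by
  rw [← xwBil_swap ends s y o u p, ← xwBil_swap ends s y o u (Function.update p e 0)]
  exact xwBil_eq_yu_edge ends y s u o p he

variable (ends s y) in
/-- **The `s–o` edge-removal reduction**: if `0 ≤ D_so` ((C-so) at `p[e↦0]`) and (XW) holds with
`e` closed, then (XW) holds at `p`. -/
theorem xwBil_nonneg_of_dSO_nonneg [LinearOrder R] [IsStrictOrderedRing R] {p : E → R}
    (hp : IsProbVec p) {e : E} (he : ends e = s(s, o))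
    (hD : 0 ≤ dYU ends y s u o (Function.update p e 0))
    (h0 : 0 ≤ xwBil ends s y o u (Function.update p e 0) (Function.update p e 0)) :
    0 ≤ xwBil ends s y o u p p := by
  rw [← xwBil_swap ends s y o u p]
  rw [← xwBil_swap ends s y o u (Function.update p e 0)] at h0
  exact xwBil_nonneg_of_dYU_nonneg ends y s u o hp he hD h0

end XWEdgeYU

end Summit.Ventures.PercRepro2
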